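import Mathlib
import Summits.PneNP.PneNP.Theorems.ConvexRankGatesConvexGateBlindColumnSpaceFifth
import Summits.PneNP.PneNP.Theorems.ConvexRankGatesConvexGateBlindCatchVar

/-!
# PneNP / ConvexRankGates — `ConvexGateBlind`: the column-space LP slice for every `δ < 1/4` (unconditionally)

Helpers (`--supports stmt-PneNP-10680`), COLUMN-SPACE line (prover seat 2, session 16): the eventual form of the
third-generation catch bound `…CatchVar.card_badColourings_le_var` with the unconditional ℓ₁-constant `L = 2k² − 4k + 1`
(`…CliqueNonnegL1`): first term `exp(−Ω(m/k⁴))`, second `exp(−Ω(√m/k))`, so the column-space LP slice of the crux holds for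
every `δ ∈ (0, 1/4)` (session 13: `1/11`; earlier this session: `1/5`).

* `eventually_two_mul_ceil_rpow_sq_le` — eventually `2k² ≤ m` (`δ < 1/2`).
* `eventually_catch_exponent_var` — asymptotics (`δ < 1/4`).
* `columnSpace_cliqueDistConeRankHard_quarter` (stub `columnSpace_crux_quarter`).
[new]
-/

set_option linter.dupNamespace false

namespace Summit.PneNP.PneNP.Theorems

open Finset Real Filter Literature.Computability.Complexity
open Summit.PneNP.PneNP.Cruxes.ConvexGateBlind.StrictRankConicCover (Edge cdist)

noncomputable section

/-! ## Eventually `2k² ≤ m` -/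

/-- With `k = ⌈m^δ⌉₊` and `δ < 1/2`: eventually `2k² ≤ m`. [folklore] -/
theorem eventually_two_mul_ceil_rpow_sq_le {δ : ℝ} (hδ0 : 0 < δ) (hδ : δ < 1 / 2) :
    ∀ᶠ m : ℕ in atTop, 2 * ⌈(m : ℝ) ^ δ⌉₊ ^ 2 ≤ m := by
  have hy : Tendsto (fun m : ℕ => (m : ℝ) ^ (1 - 2 * δ)) atTop atTop :=
    (tendsto_rpow_atTop (by linarith)).comp tendsto_natCast_atTop_atTop
  filter_upwards [hy.eventually_ge_atTop 8, eventually_ge_atTop 1] with m hm8 hm1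
  have hm0 : (0 : ℝ) < m := by exact_mod_cast (show 0 < m by omega)
  have hm1R : (1 : ℝ) ≤ m := by exact_mod_cast hm1
  have hxge1 : (1 : ℝ) ≤ (m : ℝ) ^ δ := Real.one_le_rpow hm1R hδ0.le
  have hK2 : (⌈(m : ℝ) ^ δ⌉₊ : ℝ) ≤ 2 * (m : ℝ) ^ δ := by
    have := Nat.ceil_lt_add_one (by positivity : (0 : ℝ) ≤ (m : ℝ) ^ δ)
    linarith
  have hsq : ((m : ℝ) ^ δ) ^ 2 = (m : ℝ) ^ (2 * δ) := by
    rw [← Real.rpow_natCast ((m : ℝ) ^ δ) 2, ← Real.rpow_mul hm0.le]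
    congr 1; push_cast; ring
  have hprod : (m : ℝ) ^ (2 * δ) * (m : ℝ) ^ (1 - 2 * δ) = m := by
    rw [← Real.rpow_add hm0]
    have : (2 * δ + (1 - 2 * δ) : ℝ) = 1 := by ring
    rw [this, Real.rpow_one]
  have h8 : (8 : ℝ) ≤ (m : ℝ) ^ (1 - 2 * δ) := hm8
  have hR : 2 * ((⌈(m : ℝ) ^ δ⌉₊ : ℝ)) ^ 2 ≤ m := by
    calc 2 * ((⌈(m : ℝ) ^ δ⌉₊ : ℝ)) ^ 2 ≤ 2 * (2 * (m : ℝ) ^ δ) ^ 2 := by gcongr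
      _ = 8 * (m : ℝ) ^ (2 * δ) := by rw [mul_pow, hsq]; ring
      _ ≤ (m : ℝ) ^ (1 - 2 * δ) * (m : ℝ) ^ (2 * δ) := mul_le_mul_of_nonneg_right h8 (by positivity)
      _ = m := by rw [mul_comm, hprod]
  exact_mod_cast hR

/-- **The third-generation catch exponent beats every polynomial (`δ < 1/4`, unconditional).** With `k = ⌈m^δ⌉₊` and `L = 2k²−4k+1`:
eventually `4 ≤ k`, `4k ≤ m`, `2k² ≤ m` and `m^c · (exp(−(k−1)(m−1)/(2304kL²)) + exp(−1/(5200√β'))) ≤ 1/4`,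
`β' = 2k(k−2)/(m−k−1)`. [new] -/
theorem eventually_catch_exponent_var {δ : ℝ} (hδ0 : 0 < δ) (hδ1 : δ < 1 / 4) (c : ℕ) :
    ∀ᶠ m : ℕ in atTop, 4 ≤ ⌈(m : ℝ) ^ δ⌉₊ ∧ 4 * ⌈(m : ℝ) ^ δ⌉₊ ≤ m ∧ 2 * ⌈(m : ℝ) ^ δ⌉₊ ^ 2 ≤ m ∧
      (m : ℝ) ^ c * (Real.exp (-((((⌈(m : ℝ) ^ δ⌉₊ : ℝ)) - 1) * ((m : ℝ) - 1) / (2304 * ⌈(m : ℝ) ^ δ⌉₊ *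
          (2 * (⌈(m : ℝ) ^ δ⌉₊ : ℝ) ^ 2 - 4 * (⌈(m : ℝ) ^ δ⌉₊ : ℝ) + 1) ^ 2))) +
        Real.exp (-(1 / (5200 * Real.sqrt (2 * ((⌈(m : ℝ) ^ δ⌉₊ : ℝ)) * (((⌈(m : ℝ) ^ δ⌉₊ : ℝ)) - 2) /
          ((m : ℝ) - ⌈(m : ℝ) ^ δ⌉₊ - 1)))))) ≤ 1 / 4 := by
  set γ₁ : ℝ := 1 - 4 * δ with hγ₁
  set γ₂ : ℝ := (1 - 2 * δ) / 2 with hγ₂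
  have hγ₁0 : 0 < γ₁ := by rw [hγ₁]; linarith
  have hγ₂0 : 0 < γ₂ := by rw [hγ₂]; linarith
  filter_upwards [eventually_ceil_rpow_ge_and_mul_le hδ0 (by linarith) 4,
    eventually_two_mul_ceil_rpow_sq_le hδ0 (by linarith),
    eventually_pow_mul_exp_le hγ₁0 (by norm_num : (0 : ℝ) < 2 ^ 20) (by norm_num : (0 : ℝ) < 1 / 8) c,
    eventually_pow_mul_exp_le hγ₂0 (by norm_num : (0 : ℝ) < 2 ^ 15) (by norm_num : (0 : ℝ) < 1 / 8) c,
    eventually_ge_atTop 2] with m hm4 hsq hE1 hE2 hm2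
  obtain ⟨hk4, hkm⟩ := hm4
  refine ⟨hk4, hkm, hsq, ?_⟩
  set k : ℕ := ⌈(m : ℝ) ^ δ⌉₊ with hk
  have hK4 : (4 : ℝ) ≤ k := by exact_mod_cast hk4
  have hKm : 4 * (k : ℝ) ≤ m := by exact_mod_cast hkm
  have hsqR : 2 * (k : ℝ) ^ 2 ≤ m := by exact_mod_cast hsq
  have hm2R : (2 : ℝ) ≤ m := by exact_mod_cast hm2
  have hm0 : (0 : ℝ) < m := by linarith
  have hm1 : (1 : ℝ) ≤ m := by linarith
  have hxge1 : (1 : ℝ) ≤ (m : ℝ) ^ δ := Real.one_le_rpow hm1 hδ0.le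
  have hK2 : (k : ℝ) ≤ 2 * (m : ℝ) ^ δ := by
    have := Nat.ceil_lt_add_one (by positivity : (0 : ℝ) ≤ (m : ℝ) ^ δ)
    rw [← hk] at this
    linarith
  set L : ℝ := 2 * (k : ℝ) ^ 2 - 4 * (k : ℝ) + 1 with hL
  set β : ℝ := 2 * (k : ℝ) * ((k : ℝ) - 2) / ((m : ℝ) - k - 1) with hβ
  have hmk : (0 : ℝ) < (m : ℝ) - k - 1 := by nlinarith
  have hL0 : 0 < L := by rw [hL]; nlinarith
  have hβ0 : 0 < β := by rw [hβ]; exact div_pos (by nlinarith) hmk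
  have hβle : β ≤ 4 * (k : ℝ) ^ 2 / m := by
    rw [hβ, div_le_div_iff₀ hmk hm0]
    -- `2k(k-2)·m ≤ 4k²(m-k-1)` iff `0 ≤ 2k²m - 4k³ - 4k² + 4km` — true as `m ≥ 2k²` and `k ≥ 4`
    have hk0 : (0 : ℝ) ≤ k := by positivity
    have h1 : 2 * (k : ℝ) ^ 2 * (k : ℝ) ^ 2 ≤ (m : ℝ) * (k : ℝ) ^ 2 :=
      mul_le_mul_of_nonneg_right hsqR (sq_nonneg _)
    nlinarith [h1, hk0]
  -- powers of `k` against powers of `m`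
  have hK2δ : (k : ℝ) ^ 2 ≤ 2 ^ 2 * (m : ℝ) ^ (2 * δ) := by
    calc (k : ℝ) ^ 2 ≤ (2 * (m : ℝ) ^ δ) ^ 2 := pow_le_pow_left₀ (by positivity) hK2 2
      _ = 2 ^ 2 * ((m : ℝ) ^ δ) ^ 2 := by rw [mul_pow]
      _ = 2 ^ 2 * (m : ℝ) ^ (2 * δ) := by
          have e3 : δ * ((2 : ℕ) : ℝ) = 2 * δ := by push_cast; ring
          rw [← Real.rpow_natCast ((m : ℝ) ^ δ) 2, ← Real.rpow_mul hm0.le, e3]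
  have hK4δ : (k : ℝ) ^ 4 ≤ 2 ^ 4 * (m : ℝ) ^ (4 * δ) := by
    calc (k : ℝ) ^ 4 ≤ (2 * (m : ℝ) ^ δ) ^ 4 := pow_le_pow_left₀ (by positivity) hK2 4
      _ = 2 ^ 4 * ((m : ℝ) ^ δ) ^ 4 := by rw [mul_pow]
      _ = 2 ^ 4 * (m : ℝ) ^ (4 * δ) := by
          have e3 : δ * ((4 : ℕ) : ℝ) = 4 * δ := by push_cast; ring
          rw [← Real.rpow_natCast ((m : ℝ) ^ δ) 4, ← Real.rpow_mul hm0.le, e3]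
  -- FIRST TERM: `E₁ = (k-1)(m-1)/(2304 k L²) ≥ m^{γ₁}/2^20`
  set E₁ : ℝ := ((k : ℝ) - 1) * ((m : ℝ) - 1) / (2304 * k * L ^ 2) with hE₁
  have hLle : L ≤ 2 * (k : ℝ) ^ 2 := by rw [hL]; nlinarith
  have hE₁ge : (m : ℝ) ^ γ₁ / 2 ^ 20 ≤ E₁ := by
    have hden : 0 < 2304 * (k : ℝ) * L ^ 2 := by positivity
    rw [hE₁, div_le_div_iff₀ (by positivity) hden]
    -- `m^{γ₁}·2304 k L² ≤ 2^20 (k-1)(m-1)`: `L² ≤ 4k⁴ ≤ 64 m^{4δ}`, `m^{γ₁} m^{4δ} = m`, `k ≤ 2(k−1)`, `m ≤ 2(m−1)`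
    have hL2 : L ^ 2 ≤ 4 * (k : ℝ) ^ 4 := by
      calc L ^ 2 ≤ (2 * (k : ℝ) ^ 2) ^ 2 := pow_le_pow_left₀ hL0.le hLle 2
        _ = 4 * (k : ℝ) ^ 4 := by ring
    have hprod : (m : ℝ) ^ γ₁ * (m : ℝ) ^ (4 * δ) = m := by
      rw [← Real.rpow_add hm0, hγ₁]
      have : (1 - 4 * δ + 4 * δ : ℝ) = 1 := by ring
      rw [this, Real.rpow_one]
    have hmγ0 : 0 ≤ (m : ℝ) ^ γ₁ := by positivity
    have hk0 : (0 : ℝ) ≤ k := by positivity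
    calc (m : ℝ) ^ γ₁ * (2304 * k * L ^ 2) = 2304 * k * ((m : ℝ) ^ γ₁ * L ^ 2) := by ring
      _ ≤ 2304 * k * ((m : ℝ) ^ γ₁ * (4 * (2 ^ 4 * (m : ℝ) ^ (4 * δ)))) := by
          refine mul_le_mul_of_nonneg_left (mul_le_mul_of_nonneg_left (hL2.trans (by linarith)) hmγ0) (by positivity)
      _ = 2304 * 64 * k * ((m : ℝ) ^ γ₁ * (m : ℝ) ^ (4 * δ)) := by ring
      _ = 2304 * 64 * k * m := by rw [hprod]
      _ ≤ ((k : ℝ) - 1) * ((m : ℝ) - 1) * 2 ^ 20 := by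
          have hk1 : (k : ℝ) / 2 ≤ (k : ℝ) - 1 := by linarith
          have hm1' : (m : ℝ) / 2 ≤ (m : ℝ) - 1 := by linarith
          have hprod2 := mul_le_mul hk1 hm1' (by positivity) (by linarith)
          have hkm0 : (0 : ℝ) ≤ (k : ℝ) * m := by positivity
          nlinarith [hprod2, hkm0]

  have hT1 : (m : ℝ) ^ c * Real.exp (-E₁) ≤ 1 / 8 := hE1 E₁ hE₁ge
  -- SECOND TERM: `E₂ = 1/(5200 √β') ≥ m^{γ₂}/2^15`
  set D₂ : ℝ := 5200 * Real.sqrt β with hD₂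
  have hsqβ : 0 < Real.sqrt β := Real.sqrt_pos.2 hβ0
  have hD₂0 : 0 < D₂ := by rw [hD₂]; positivity
  have hD₂sq : D₂ ^ 2 ≤ (2 ^ 15 * (m : ℝ) ^ (-γ₂)) ^ 2 := by
    have hsq' : D₂ ^ 2 = 5200 ^ 2 * β := by rw [hD₂, mul_pow, Real.sq_sqrt hβ0.le]
    have hrhs : (2 ^ 15 * (m : ℝ) ^ (-γ₂)) ^ 2 = 2 ^ 30 * (m : ℝ) ^ (2 * δ - 1) := by
      have e1 : ((2 : ℝ) ^ 15) ^ 2 = 2 ^ 30 := by norm_num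
      have e2 : -γ₂ * ((2 : ℕ) : ℝ) = 2 * δ - 1 := by rw [hγ₂]; push_cast; ring
      rw [mul_pow, ← Real.rpow_natCast ((m : ℝ) ^ (-γ₂)) 2, ← Real.rpow_mul hm0.le, e1, e2]
    rw [hsq', hrhs]
    calc (5200 : ℝ) ^ 2 * β ≤ 5200 ^ 2 * (4 * (k : ℝ) ^ 2 / m) := mul_le_mul_of_nonneg_left hβle (by positivity)
      _ ≤ 5200 ^ 2 * (4 * (2 ^ 2 * (m : ℝ) ^ (2 * δ)) / m) := by gcongr
      _ = 5200 ^ 2 * 16 * (m : ℝ) ^ (2 * δ - 1) := by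
          rw [Real.rpow_sub_one hm0.ne']
          ring
      _ ≤ 2 ^ 30 * (m : ℝ) ^ (2 * δ - 1) := by
          have : (0 : ℝ) ≤ (m : ℝ) ^ (2 * δ - 1) := by positivity
          nlinarith
  have hD₂le : D₂ ≤ 2 ^ 15 * (m : ℝ) ^ (-γ₂) :=
    (pow_le_pow_iff_left₀ hD₂0.le (by positivity) two_ne_zero).1 hD₂sq
  have hE₂ge : (m : ℝ) ^ γ₂ / 2 ^ 15 ≤ 1 / D₂ := by
    rw [div_le_div_iff₀ (by positivity) hD₂0]
    calc (m : ℝ) ^ γ₂ * D₂ ≤ (m : ℝ) ^ γ₂ * (2 ^ 15 * (m : ℝ) ^ (-γ₂)) := mul_le_mul_of_nonneg_left hD₂le (by positivity)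
      _ = 1 * 2 ^ 15 := by
          rw [Real.rpow_neg hm0.le, mul_comm (2 ^ 15 : ℝ), ← mul_assoc,
            mul_inv_cancel₀ (Real.rpow_pos_of_pos hm0 γ₂).ne']
  have hT2 : (m : ℝ) ^ c * Real.exp (-(1 / D₂)) ≤ 1 / 8 := hE2 (1 / D₂) hE₂ge
  -- conclude
  have : (m : ℝ) ^ c * (Real.exp (-E₁) + Real.exp (-(1 / D₂))) ≤ 1 / 4 := by
    rw [mul_add]; linarith
  simpa only [hE₁, hD₂, hL, hβ] using this

/-! ## The eventual form -/

/-- **The column-space LP slice of the crux holds for every `δ ∈ (0, 1/4)` and every `c` (unconditionally).** Eventually in `m` (`k = ⌈m^δ⌉₊`), for every `ε > 0`, every `R ≤ m^c`, all `b ≥ 0` and all `k`-clique-non-negative `t₁,…,t_R`, the identity `cdist Q u − ε = ∑_l b_l(u)·t_l(E(Q))` FAILS for some `k`-set `Q` and some `k`-clique-free `u`.** [new] -/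
theorem columnSpace_cliqueDistConeRankHard_quarter {δ : ℝ} (hδ0 : 0 < δ) (hδ1 : δ < 1 / 4) (c : ℕ) :
    ∀ᶠ m : ℕ in atTop, ∀ ε : ℝ, 0 < ε → ∀ R : ℕ, R ≤ m ^ c →
      ∀ (t : Fin R → Edge m → ℝ) (b : (Edge m → Bool) → Fin R → ℝ),
      (∀ l (Q : Finset (Fin m)), Q.card = ⌈(m : ℝ) ^ δ⌉₊ → 0 ≤ ∑ e, if cliqueVec Q e = true then t l e else 0) →
      (∀ u l, 0 ≤ b u l) →
      ¬ ∀ (Q : Finset (Fin m)) (u : Edge m → Bool), Q.card = ⌈(m : ℝ) ^ δ⌉₊ → cliqueFn m ⌈(m : ℝ) ^ δ⌉₊ u = false →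
          cdist Q u - ε = ∑ l, b u l * ∑ e, (if cliqueVec Q e = true then t l e else 0) := by
  filter_upwards [eventually_catch_exponent_var hδ0 hδ1 c] with m hm
  obtain ⟨hkB, hkm, hsq, hsmall⟩ := hm
  intro ε hε R hR t b ht hb hall
  set k : ℕ := ⌈(m : ℝ) ^ δ⌉₊ with hk
  have hk4 : 4 ≤ k := by omega
  have hkm2 : k + 2 ≤ m := by nlinarith
  have hkR : (4 : ℝ) ≤ k := by exact_mod_cast hk4
  have hL1 : (1 : ℝ) ≤ 2 * (k : ℝ) ^ 2 - 4 * k + 1 := by nlinarith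
  have hLq : (k : ℝ) - 1 ≤ 12 * (2 * (k : ℝ) ^ 2 - 4 * k + 1) := by nlinarith
  set θ : ℝ := Real.exp (-(((k : ℝ) - 1) * ((m : ℝ) - 1) / (2304 * k * (2 * (k : ℝ) ^ 2 - 4 * k + 1) ^ 2))) +
    Real.exp (-(1 / (5200 * Real.sqrt (2 * (k : ℝ) * ((k : ℝ) - 2) / ((m : ℝ) - k - 1))))) with hθ
  have hlb := restricted_terms_lower_bound_of_catch (by omega) hkm2 t ht b hb ε hε hall θ
    (fun w hw => by
      have h := card_badColourings_le_var hk4 hsq (2 * (k : ℝ) ^ 2 - 4 * k + 1) hL1 hLq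
        (fun v hv => abs_sum_le_of_cliqueNonneg_at hk4 hkm2 v hv) w hw
      rw [hθ, mul_add]
      exact h)
  have hθ0 : 0 < θ := by rw [hθ]; positivity
  have hq3 : (3 : ℝ) ≤ ((k - 1 : ℕ) : ℝ) := by
    have : 3 ≤ k - 1 := by omega
    exact_mod_cast this
  set qm : ℝ := ((k - 1 : ℕ) : ℝ) ^ m with hqm
  have hqm0 : 0 < qm := by rw [hqm]; positivity
  have hq_le : ((k - 1 : ℕ) : ℝ) ≤ qm / 2 := by
    obtain ⟨m', hm'⟩ : ∃ m', m = m' + 2 := ⟨m - 2, by omega⟩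
    rw [hqm, hm', pow_succ, pow_succ]
    have h1 : (1 : ℝ) ≤ ((k - 1 : ℕ) : ℝ) ^ m' := one_le_pow₀ (by linarith)
    have hQ0 : (0 : ℝ) ≤ ((k - 1 : ℕ) : ℝ) := by positivity
    have h2 := mul_le_mul h1 hq3 (by norm_num) (by positivity)
    have h3 := mul_le_mul_of_nonneg_right h2 hQ0
    linarith
  have hRθ : (R : ℝ) * (qm * θ) ≤ qm / 4 := by
    have hR' : (R : ℝ) ≤ (m : ℝ) ^ c := by exact_mod_cast hR
    calc (R : ℝ) * (qm * θ) ≤ (m : ℝ) ^ c * (qm * θ) := mul_le_mul_of_nonneg_right hR' (by positivity)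
      _ = qm * ((m : ℝ) ^ c * θ) := by ring
      _ ≤ qm * (1 / 4) := mul_le_mul_of_nonneg_left hsmall hqm0.le
      _ = qm / 4 := by ring
  linarith

/-- **The column-space LP slice of the crux, every `δ < 1/4`** (registered form of `columnSpace_cliqueDistConeRankHard_quarter`). [new] -/
theorem columnSpace_crux_quarter : ∀ (δ : ℝ), 0 < δ → δ < 1 / 4 → ∀ c : ℕ, ∀ᶠ m : ℕ in Filter.atTop, ∀ ε : ℝ, 0 < ε → ∀ R : ℕ, R ≤ m ^ c → ∀ (t : Fin R → Edge m → ℝ) (b : (Edge m → Bool) → Fin R → ℝ), (∀ l (Q : Finset (Fin m)), Q.card = ⌈(m : ℝ) ^ δ⌉₊ → 0 ≤ ∑ e, if cliqueVec Q e = true then t l e else 0) → (∀ u l, 0 ≤ b u l) → ¬ ∀ (Q : Finset (Fin m)) (u : Edge m → Bool), Q.card = ⌈(m : ℝ) ^ δ⌉₊ → cliqueFn m ⌈(m : ℝ) ^ δ⌉₊ u = false → cdist Q u - ε = ∑ l, b u l * ∑ e, (if cliqueVec Q e = true then t l e else 0) :=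
  fun _ hδ0 hδ1 c => columnSpace_cliqueDistConeRankHard_quarter hδ0 hδ1 c

end

end Summit.PneNP.PneNP.Theorems
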